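import Literature.MathematicalPhysics.QuantumFieldTheory.Balaban1983to89.B6BlockDecayGDivFactorsV1
import Literature.MathematicalPhysics.QuantumFieldTheory.Balaban1983to89.B6Prop25BoundedTwoScaleV1

/-!
# `Balaban1983to89.B6Ineq190GradTwoScaleV1` — T. Bałaban, *Propagators and renormalization transformations for lattice gauge theories. II*,
# Commun. Math. Phys. **96** (1984) 223–250 [Balaban1984PropagatorsII], p. 246 «all the necessary properties of the operators H_j, G̃_j …
# follow from the Proposition 1.2 [of [4]]»: [4] (1.90) `Δ_a ≥ γ₀(Δ + I)` WITH ITS GRADIENT TERM for `M_j = Δ − ∂P_j∂*` of the two-scale V1 data on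
# `{Q_jA = 0}`, the form bound `⟨∇_λ*J, G̃_j∇_λ*J⟩ ≤ γ₀⁻¹‖J‖²`, and the identity (2.129) AS A FORM at a vector — file 16 of the two-level
# programme (the inputs of the energy route to the global `L²` gradient members of Prop. 2.5, file 17)

statement-level skeleton of published theorems with citation tags; proofs where landed; nothing here is a claim about the Yang–Mills mass gap

PRINT (verbatim).  [4] = [Balaban1984PropagatorsI] p. 33 [PDF 17], Prop. 1.1: *"The operator G is a symmetric operator on L²(T_η) and ‖GJ‖, ‖∇GJ‖,
‖G∇*J‖, ‖∇G∇*J‖, ‖∇∇GJ‖, ‖G∇*∇*J‖ ≤ γ₀⁻¹‖J‖, (1.89) with a positive constant γ₀ independent of k, T_η, and depending on d only (if we put a = 1).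
This implies the bound from below: Δ_a = G⁻¹ ≥ γ₀(Δ + I). (1.90)"*  [B6] p. 246: *"From these representations we obtain all the necessary properties
of the operators H_j, G̃_j. They follow from the Proposition 1.2 and from the formulas and the inequalities (1.99)–(1.101) for Q_jG_jQ_j*"*, and
(2.129): *"⟨J,GJ⟩ = ⟨J,∂H′_jC^{(j)}_ΛH′_j*∂*J⟩ + ⟨(J − ∂ΔH′_jC^{(j)}_ΛH′_j*∂*J), (G̃_j + H_jC̃^{(j)}_ΛH_j*)(J − ∂ΔH′_jC^{(j)}_ΛH′_j*∂*J)⟩"*.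

WHAT THIS FILE DOES.  §1 three elementary finite-dimensional lemmas (ours): `inner_sub_le_two_mul` (`⟨a − b, M(a − b)⟩ ≤ 2⟨a, Ma⟩ + 2⟨b, Mb⟩` for a
non-negative form), the variational bound **`inner_covOp_le_of_sq_le`** for p22's covariance `…B6CovarianceOperator.covOp K S` (`⟨k, x⟩² ≤ c⟨k, Sk⟩`
on `K` ⇒ `⟨x, Cx⟩ ≤ c`), and «form ⇒ norm» by Cauchy–Schwarz twice, **`norm_sq_apply_le_of_forms`** (`S = S* ≥ 0`, `⟨x, Sx⟩ ≤ α`, `⟨T*y, ST*y⟩ ≤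
β‖y‖²` ⇒ `‖TSx‖² ≤ αβ`).  §2 the one new analytic input of the energy route: **`gammaZero_mul_le_inner_Mj`** — for the concrete data
`…B6SectCTwoScaleV1Lattice.tsV1` at `c = η⁻¹ = L^j` and `A` with `Q_jA = 0`, `γ₀(d,1)·(‖∇_λA‖² + ‖A‖²) ≤ ⟨A, M_jA⟩`, `∇_λ = n(S_λ − I)` the fine
forward difference (gen 13's `…B6HjGtOpNormV1.inner_Mj_ge_of_Qv_eq_zero` kept only `‖A‖²`: on `{Q_jA = 0}` the form of `M_j` is the whole-torus
`⟨A, Δ_aA⟩` with [4]'s `a = 1`, r03's bridge `form_deltaAE` carries it to r02's matrix form, r02's `ineq190_form` is (1.90) with `Δ = Σ_ν∇_ν*∇_ν`;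
we keep the `ν = λ` term through the carrier identity **`nsq_fdiff_TV`**: r02's `∇_ν` of `Ã` has `Σ|·|² = Σ_b (n(A(b + e_ν) − A(b)))²`), whence
**`inner_Gt_Dadj_le`**: `⟨∇_λ*J, G̃_j∇_λ*J⟩ ≤ γ₀⁻¹‖J‖²` (`G̃_j` the covariance of `M_j` on `{Q_jA = 0}`; `⟨k, ∇_λ*J⟩² = ⟨∇_λk, J⟩² ≤
γ₀⁻¹⟨k, M_jk⟩‖J‖²`).  §3 **`inner_G_le_of_bounds_at`**: (2.129) as a form at a vector `u` for any `TwoScaleData` with the printed identities and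
positivity — `⟨u, Gu⟩ ≤ X_CY₁² + 2(Y_G + X_CtY_H²) + 2(X_G + X_H²X_Ct)(X₃X_CY₁)²` from `‖H′_j*∂*u‖ ≤ Y₁`, `‖H_j*u‖ ≤ Y_H`, `⟨u, G̃_ju⟩ ≤ Y_G` and
the global numbers `X₃ ≥ ‖∂ΔH′_j‖`, `X_H ≥ ‖H_j‖`, `X_C ≥ C^{(j)}_Λ`, `X_G ≥ G̃_j`, `X_Ct ≥ C̃^{(j)}_Λ` (gen 13's `inner_G_le_of_bounds` is the case
`u = J`).

HONEST SCOPE / DIVERGENCES. (1) Elementary lemmas and one form inequality; the members of (1.89) themselves are in file 17. (2) `∇_λ = n(S_λ − I)`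
componentwise on fine bond fields, `∇_λ* = n(S_λ⁻¹ − I)` its `ℓ²`-adjoint (file 12's `adjoint_Dop`). (3) Finite tori of the V1 calculus, every
`P : Params`, `c = L^j`, `j + 1 ≤ m + K`, positive weights; `γ₀ = …B5Prop11Lattice.gammaZero P.d 1` (r02's, dimension-only). (4) No definition,
no new hypothesis; everything imported BY NAME.  NOT summit progress.  Unit `lit-balaban-p22` (gen 15), 2026-08-22.
-/

noncomputable section

open scoped InnerProductSpace BigOperators Matrix
open Finset

namespace Literature.MathematicalPhysics.QuantumFieldTheory.Balaban1983to89.B6Ineq190GradTwoScaleV1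

open LatticeFieldCalculus B5SectBStatements B5Eq117TorusCarriers B6SectADomainsV1 B6SectAOperatorsV1 B6SectAVectorModelV1 B6SectCOperators
  B6SectCOperators.TwoScaleData B6SectCTwoScaleV1 B6SectCTwoScaleV1Lattice B6CovarianceOperator
open BalabanImbrieJaffe1984to88.BIJ85AxialPropagator411 (BondSpace)
open B5Prop11Plancherel (Tor fine fdiff)
open B5Prop11Lower (Lap nsq form_gram nsq_nonneg)
open B5Prop11Lattice (gammaZero gammaZero_pos ineq190_form)
open B5DeltaA169 (DeltaA)
open B5G183FreeRowSum (fdiff_mulVec)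
open B6HprimeOpNormV1 (EK_shift)
open B6HjGtOpNormV1 (inner_sq_le_of_symm_nonneg norm_le_of_form_le norm_adjoint_le inner_covOp_nonneg qpE_whole_eq_zero_iff inner_QE_aE_whole)
open B6GOneLevelV1Bridge (TV TV_apply_EK bondEK bondEK_apply form_deltaAE star_TV_dotProduct_TV natCast_pow_eq)
open B6Eq2130TwoScaleV1Landau (Rj_eq_RE)
open B6SectCPositivity (C_symm Dp_pos Mj_pos_ker Sb_pos)
open B6Repr2129Positivity (eq2129_of_pos)
open B6BlockDecayGradFactorsV1 (Dop_comp_apply)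
open B6BlockDecayGDivBridgeV1 (adjoint_Dop)
open B6Prop25BoundedTwoScaleV1 (inner_K1_eq dv_eq_adjoint_grad)
open B5WalkCarrierTorus (normSq_eq)

/-! ## §1  Three elementary finite-dimensional lemmas (ours) -/

section Generic

variable {E F : Type*} [NormedAddCommGroup E] [InnerProductSpace ℝ E] [NormedAddCommGroup F] [InnerProductSpace ℝ F]

/-- `⟨a − b, M(a − b)⟩ ≤ 2⟨a, Ma⟩ + 2⟨b, Mb⟩` for a non-negative form (`⟨a + b, M(a + b)⟩ ≥ 0`). [cite: Balaban1984PropagatorsII, (2.129) p.246 (the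
factor `I − K₂`; elementary step, ours)] -/
theorem inner_sub_le_two_mul (M : E →ₗ[ℝ] E) (h0 : ∀ v, 0 ≤ ⟪v, M v⟫_ℝ) (a b : E) :
    ⟪a - b, M (a - b)⟫_ℝ ≤ 2 * ⟪a, M a⟫_ℝ + 2 * ⟪b, M b⟫_ℝ := by
  have h := h0 (a + b)
  rw [map_add, inner_add_left, inner_add_right, inner_add_right] at h
  rw [map_sub, inner_sub_left, inner_sub_right, inner_sub_right]
  linarith

variable [FiniteDimensional ℝ E] [FiniteDimensional ℝ F]

/-- **the variational bound for a covariance**: if `⟨k, x⟩² ≤ c·⟨k, Sk⟩` for every `k ∈ K`, then `⟨x, Cx⟩ ≤ c` (`C = covOp K S`; at `k = Cx ∈ K`,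
`⟨k, Sk⟩ = ⟨k, x⟩ = ⟨x, Cx⟩`). [cite: Balaban1984PropagatorsII, (2.131) p.246 («all the necessary properties of … G̃_j»; elementary step, ours)] -/
theorem inner_covOp_le_of_sq_le (K : Submodule ℝ E) (S : E →ₗ[ℝ] E) (hpos : ∀ k : ↥K, k ≠ 0 → 0 < ⟪(k : E), S k⟫_ℝ)
    {c : ℝ} (hc : 0 ≤ c) (x : E) (h : ∀ k : ↥K, ⟪(k : E), x⟫_ℝ ^ 2 ≤ c * ⟪(k : E), S k⟫_ℝ) :
    ⟪x, covOp K S x⟫_ℝ ≤ c := by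
  set k : ↥K := covOpT K S x with hk
  have hcov : covOp K S x = (k : E) := rfl
  have ht : ⟪x, covOp K S x⟫_ℝ = ⟪(k : E), x⟫_ℝ := by rw [hcov, real_inner_comm]
  have hS : ⟪(k : E), S k⟫_ℝ = ⟪(k : E), x⟫_ℝ := by rw [← hcov]; exact covOp_sol K S hpos k x
  have h1 := h k
  rw [hS] at h1
  rw [ht]
  by_cases h0 : ⟪(k : E), x⟫_ℝ ≤ 0
  · exact h0.trans hc
  · nlinarith [h1, not_le.mp h0]

/-- **Cauchy–Schwarz twice**: for `S = S* ≥ 0`, `⟨x, Sx⟩ ≤ α` and `⟨T*y, ST*y⟩ ≤ β‖y‖²` for all `y` give `‖TSx‖² ≤ αβ` (`‖TSx‖² = ⟨x, S(T*TSx)⟩`).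
[cite: Balaban1984PropagatorsI, (1.89) p.33 (the step «form ⇒ norm»; ours)] -/
theorem norm_sq_apply_le_of_forms (S : E →ₗ[ℝ] E) (hS : ∀ x y, ⟪S x, y⟫_ℝ = ⟪x, S y⟫_ℝ) (h0 : ∀ x, 0 ≤ ⟪x, S x⟫_ℝ)
    (T : E →ₗ[ℝ] F) {α β : ℝ} (hβ : 0 ≤ β) (x : E) (hx : ⟪x, S x⟫_ℝ ≤ α)
    (hT : ∀ y : F, ⟪LinearMap.adjoint T y, S (LinearMap.adjoint T y)⟫_ℝ ≤ β * ‖y‖ ^ 2) :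
    ‖T (S x)‖ ^ 2 ≤ α * β := by
  have hα : 0 ≤ α := (h0 x).trans hx
  have h1 : ‖T (S x)‖ ^ 2 = ⟪x, S (LinearMap.adjoint T (T (S x)))⟫_ℝ := by
    rw [← hS, LinearMap.adjoint_inner_right, real_inner_self_eq_norm_sq]
  have h2 : (‖T (S x)‖ ^ 2) ^ 2 ≤ α * (β * ‖T (S x)‖ ^ 2) :=
    calc (‖T (S x)‖ ^ 2) ^ 2 = ⟪x, S (LinearMap.adjoint T (T (S x)))⟫_ℝ ^ 2 := by rw [← h1]
      _ ≤ ⟪x, S x⟫_ℝ * ⟪LinearMap.adjoint T (T (S x)), S (LinearMap.adjoint T (T (S x)))⟫_ℝ :=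
          inner_sq_le_of_symm_nonneg S hS h0 x _
      _ ≤ α * (β * ‖T (S x)‖ ^ 2) := mul_le_mul hx (hT _) (h0 _) hα
  by_cases hw0 : T (S x) = 0
  · rw [hw0, norm_zero, sq, mul_zero]; positivity
  · have hpos : 0 < ‖T (S x)‖ ^ 2 := by positivity
    nlinarith [h2, hpos]

end Generic

/-! ## §2  [4] (1.90) with its gradient term for `M_j` on `{Q_jA = 0}` (scaling `c = η⁻¹ = L^j`) -/

section Gradient190

variable {P : Params} {j : ℕ} (hc : ((P.L : ℝ) ^ j) ≠ 0) (hj : j + 1 ≤ P.m + P.K) (Λ' : Finset (Site P (j + 1)))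
  {w : CIdx j Λ' → ℝ} (hw : ∀ i, 0 < w i)

/-- **the carrier identity for `∇_ν`**: r02's forward difference `∇_ν` (factor `η⁻¹ = L^j`) of `Ã` has `Σ|·|² = Σ_b (n(A(b + e_ν) − A(b)))²`, the V1
`‖∇_νA‖²`. [cite: Balaban1984PropagatorsI, (1.31) p.23, (1.18) p.20] -/
theorem nsq_fdiff_TV (hj' : j ≤ P.m + P.K) (lam : Fin P.d) (v : BondSpace P) :
    nsq (fdiff (fine (P.L ^ j) (Mk P j)) ((P.L ^ j : ℕ) : ℂ) lam *ᵥ TV hj' v) =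
      ∑ b : PBond P 0, (((P.L : ℝ) ^ j) * (v ⟨b.src.shift lam, b.dir⟩ - v b)) ^ 2 := by
  unfold nsq
  symm
  refine Fintype.sum_equiv (bondEK hj') _ _ fun b => ?_
  rw [bondEK_apply, fdiff_mulVec, ← EK_shift hj' b.src lam,
    show (EK hj' (b.src.shift lam), b.dir) = (EK hj' (⟨b.src.shift lam, b.dir⟩ : PBond P 0).src, (⟨b.src.shift lam, b.dir⟩ : PBond P 0).dir)
      from rfl, TV_apply_EK, TV_apply_EK, natCast_pow_eq, ← Complex.ofReal_sub, ← Complex.ofReal_mul, Complex.norm_real, Real.norm_eq_abs,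
    sq_abs]

include hj hw in
/-- **[4] (1.90) WITH ITS GRADIENT TERM, for `M_j = Δ − ∂P_j∂*` of the two-scale V1 data on `{Q_jA = 0}`**: `γ₀(d,1)·(‖∇_λA‖² + ‖A‖²) ≤ ⟨A, M_jA⟩`
whenever `Q_jA = 0` (`γ₀ = …B5Prop11Lattice.gammaZero P.d 1`; on `{Q_jA = 0}` the form of `M_j` is the whole-torus `⟨A, Δ_aA⟩` with [4]'s `a = 1`,
which r03's bridge carries to r02's matrix form, where (1.90) `Δ_a ≥ γ₀(Σ_ν∇_ν*∇_ν + I)` holds; keep the `ν = λ` term) — uniformly in the volume and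
in `Λ′`. [cite: Balaban1984PropagatorsI, (1.90) p.33; Balaban1984PropagatorsII, p.246, text after (2.131)] -/
theorem gammaZero_mul_le_inner_Mj (v : BondSpace P) (hv : (tsV1 hc Λ' w).Qv v = 0) (lam : Fin P.d) :
    gammaZero P.d 1 * (∑ b : PBond P 0, (((P.L : ℝ) ^ j) * (v ⟨b.src.shift lam, b.dir⟩ - v b)) ^ 2 + ‖v‖ ^ 2) ≤
      ⟪v, (tsV1 hc Λ' w).Mj v⟫_ℝ := by
  have hL := isLattice Λ' hc hj hw
  have hj' : j ≤ P.m + P.K := Nat.le_of_succ_le hj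
  -- (a) on `{Q_jA = 0}` the form of `M_j` is the whole-torus `⟨A, Δ_aA⟩` (weight `n^d`)
  have hQE : ∀ i, QE (Domains.whole (P := P) j hj') v i = 0 := by
    intro i
    obtain ⟨b, rfl⟩ := (B6SectAWholeTorusData.idxB_bijective hj').2 i
    have e : QE (Domains.whole (P := P) j hj') v (B6SectAWholeTorusData.idxB hj' b) = (tsV1 hc Λ' w).Qv v b := rfl
    rw [e, hv]
    rfl
  have h1 : ⟪v, (tsV1 hc Λ' w).Mj v⟫_ℝ =
      ⟪v, deltaAE (Domains.whole (P := P) j hj') ((P.L : ℝ) ^ j) (fun _ => (1 : ℝ) * ((P.L : ℝ) ^ j) ^ P.d) v⟫_ℝ := by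
    have hz : ∑ i, (fun _ : BondIdx (Domains.whole (P := P) j hj') => (1 : ℝ) * ((P.L : ℝ) ^ j) ^ P.d) i *
        QE (Domains.whole (P := P) j hj') v i ^ 2 = 0 :=
      Finset.sum_eq_zero fun i _ => by rw [hQE i]; ring
    rw [form_Mj hL, inner_deltaAE_self, hz, add_zero, Rj_eq_RE hc Λ' hj']
    rfl
  -- (b) r03's bridge: the V1 form is r02's matrix form with `a = 1`
  have h2 := form_deltaAE hj' (Domains.whole (P := P) j hj') (qpE_whole_eq_zero_iff hj') one_pos (inner_QE_aE_whole hj' 1) v v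
  -- (c) r02's (1.90) and the `ν = λ` term of `Σ_ν∇_ν*∇_ν`
  have hn : 1 ≤ P.L ^ j := Nat.one_le_pow _ _ P.L_pos
  have h3 := ineq190_form (P.L ^ j) hn (Mk P j) 1 one_pos (TV hj' v)
  have h4 : ∑ b : PBond P 0, (((P.L : ℝ) ^ j) * (v ⟨b.src.shift lam, b.dir⟩ - v b)) ^ 2 + ‖v‖ ^ 2 ≤
      (star (TV hj' v) ⬝ᵥ ((Lap (P.L ^ j) (Mk P j) + 1) *ᵥ TV hj' v)).re := by
    have hsum : (star (TV hj' v) ⬝ᵥ (Lap (P.L ^ j) (Mk P j) *ᵥ TV hj' v)).re =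
        ∑ ν, nsq (fdiff (fine (P.L ^ j) (Mk P j)) ((P.L ^ j : ℕ) : ℂ) ν *ᵥ TV hj' v) := by
      rw [Lap, Matrix.sum_mulVec, dotProduct_sum, Complex.re_sum]
      exact Finset.sum_congr rfl fun ν _ => by rw [form_gram, Complex.ofReal_re]
    have hlam : nsq (fdiff (fine (P.L ^ j) (Mk P j)) ((P.L ^ j : ℕ) : ℂ) lam *ᵥ TV hj' v) ≤
        ∑ ν, nsq (fdiff (fine (P.L ^ j) (Mk P j)) ((P.L ^ j : ℕ) : ℂ) ν *ᵥ TV hj' v) :=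
      Finset.single_le_sum (f := fun ν => nsq (fdiff (fine (P.L ^ j) (Mk P j)) ((P.L ^ j : ℕ) : ℂ) ν *ᵥ TV hj' v))
        (fun ν _ => nsq_nonneg _) (Finset.mem_univ lam)
    rw [Matrix.add_mulVec, Matrix.one_mulVec, dotProduct_add, Complex.add_re, star_TV_dotProduct_TV, Complex.ofReal_re,
      real_inner_self_eq_norm_sq, hsum, ← nsq_fdiff_TV hj' lam v]
    linarith
  have h5 : (star (TV hj' v) ⬝ᵥ (DeltaA (P.L ^ j) (Mk P j) 1 *ᵥ TV hj' v)).re = ⟪v, (tsV1 hc Λ' w).Mj v⟫_ℝ := by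
    rw [h2, Complex.ofReal_re, ← h1]
  calc gammaZero P.d 1 * (∑ b : PBond P 0, (((P.L : ℝ) ^ j) * (v ⟨b.src.shift lam, b.dir⟩ - v b)) ^ 2 + ‖v‖ ^ 2)
      ≤ gammaZero P.d 1 * (star (TV hj' v) ⬝ᵥ ((Lap (P.L ^ j) (Mk P j) + 1) *ᵥ TV hj' v)).re :=
        mul_le_mul_of_nonneg_left h4 (gammaZero_pos _ _).le
    _ ≤ _ := h3.trans_eq h5

include hj hw in
/-- **`⟨∇_λ*J, G̃_j∇_λ*J⟩ ≤ γ₀⁻¹‖J‖²`** for the concrete `G̃_j` (the covariance of `M_j` on `{Q_jA = 0}`): for `k` with `Q_jk = 0`,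
`⟨k, ∇_λ*J⟩² = ⟨∇_λk, J⟩² ≤ ‖∇_λk‖²‖J‖² ≤ γ₀⁻¹⟨k, M_jk⟩‖J‖²`, and §1's variational bound. [cite: Balaban1984PropagatorsII, (2.131) p.246;
Balaban1984PropagatorsI, (1.89)–(1.90) p.33] -/
theorem inner_Gt_Dadj_le (lam : Fin P.d) (J : BondSpace P) :
    ⟪(((((P.L : ℝ) ^ j) • (onE (LinearMap.funLeft ℝ ℝ (fun b : PBond P 0 => (⟨b.src.unshift lam, b.dir⟩ : PBond P 0))) - LinearMap.id) :
        BondSpace P →ₗ[ℝ] BondSpace P)) J),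
      (tsV1 hc Λ' w).Gt (((((P.L : ℝ) ^ j) • (onE (LinearMap.funLeft ℝ ℝ (fun b : PBond P 0 => (⟨b.src.unshift lam, b.dir⟩ : PBond P 0))) -
        LinearMap.id) : BondSpace P →ₗ[ℝ] BondSpace P)) J)⟫_ℝ ≤ (gammaZero P.d 1)⁻¹ * ‖J‖ ^ 2 := by
  have hγ := gammaZero_pos P.d 1
  rw [← adjoint_Dop]
  refine inner_covOp_le_of_sq_le (tsV1 hc Λ' w).NA (tsV1 hc Λ' w).Mj
    (fun k hk => Mj_pos_ker (isLattice Λ' hc hj hw) (positive Λ' hc hj w) (k : BondSpace P) (LinearMap.mem_ker.mp k.2)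
      (fun h => hk (Subtype.ext h))) (by positivity) _ fun k => ?_
  have hk : (tsV1 hc Λ' w).Qv (k : BondSpace P) = 0 := LinearMap.mem_ker.mp k.2
  have hM := gammaZero_mul_le_inner_Mj hc hj Λ' hw (k : BondSpace P) hk lam
  -- `⟨k, ∇_λ*J⟩ = ⟨∇_λk, J⟩`, `‖∇_λk‖² = Σ_b (n(k(b + e_λ) − k(b)))²`
  rw [LinearMap.adjoint_inner_right]
  have hD : ‖((((P.L : ℝ) ^ j) • (onE (LinearMap.funLeft ℝ ℝ (fun b : PBond P 0 => (⟨b.src.shift lam, b.dir⟩ : PBond P 0))) - LinearMap.id) :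
      BondSpace P →ₗ[ℝ] BondSpace P)) (k : BondSpace P)‖ ^ 2 =
      ∑ b : PBond P 0, (((P.L : ℝ) ^ j) * ((k : BondSpace P) ⟨b.src.shift lam, b.dir⟩ - (k : BondSpace P) b)) ^ 2 := by
    rw [normSq_eq]
    refine Finset.sum_congr rfl fun b _ => ?_
    have e := Dop_comp_apply ((P.L : ℝ) ^ j) lam (LinearMap.id : BondSpace P →ₗ[ℝ] BondSpace P) (k : BondSpace P) b
    rw [LinearMap.comp_id] at e
    rw [e, LinearMap.id_apply]
  have hCS := abs_real_inner_le_norm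
    (((((P.L : ℝ) ^ j) • (onE (LinearMap.funLeft ℝ ℝ (fun b : PBond P 0 => (⟨b.src.shift lam, b.dir⟩ : PBond P 0))) - LinearMap.id) :
      BondSpace P →ₗ[ℝ] BondSpace P)) (k : BondSpace P)) J
  have h1 : ⟪((((P.L : ℝ) ^ j) • (onE (LinearMap.funLeft ℝ ℝ (fun b : PBond P 0 => (⟨b.src.shift lam, b.dir⟩ : PBond P 0))) - LinearMap.id) :
      BondSpace P →ₗ[ℝ] BondSpace P)) (k : BondSpace P), J⟫_ℝ ^ 2 ≤
      (∑ b : PBond P 0, (((P.L : ℝ) ^ j) * ((k : BondSpace P) ⟨b.src.shift lam, b.dir⟩ - (k : BondSpace P) b)) ^ 2) * ‖J‖ ^ 2 := by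
    rw [← hD, ← mul_pow, ← sq_abs]
    exact pow_le_pow_left₀ (abs_nonneg _) hCS 2
  have h2 : ∑ b : PBond P 0, (((P.L : ℝ) ^ j) * ((k : BondSpace P) ⟨b.src.shift lam, b.dir⟩ - (k : BondSpace P) b)) ^ 2 ≤
      (gammaZero P.d 1)⁻¹ * ⟪(k : BondSpace P), (tsV1 hc Λ' w).Mj k⟫_ℝ := by
    rw [le_inv_mul_iff₀ hγ]
    nlinarith [hM, sq_nonneg ‖(k : BondSpace P)‖, hγ]
  calc _ ≤ (∑ b : PBond P 0, (((P.L : ℝ) ^ j) * ((k : BondSpace P) ⟨b.src.shift lam, b.dir⟩ - (k : BondSpace P) b)) ^ 2) * ‖J‖ ^ 2 := h1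
    _ ≤ (gammaZero P.d 1)⁻¹ * ⟪(k : BondSpace P), (tsV1 hc Λ' w).Mj k⟫_ℝ * ‖J‖ ^ 2 := mul_le_mul_of_nonneg_right h2 (sq_nonneg _)
    _ = (gammaZero P.d 1)⁻¹ * ‖J‖ ^ 2 * ⟪(k : BondSpace P), (tsV1 hc Λ' w).Mj k⟫_ℝ := by ring

end Gradient190

/-! ## §3  The abstract assembly through (2.129) at a vector `u` -/

section Abstract

variable {A B W T Bs V : Type*}
  [NormedAddCommGroup A] [InnerProductSpace ℝ A] [FiniteDimensional ℝ A]
  [NormedAddCommGroup B] [InnerProductSpace ℝ B] [FiniteDimensional ℝ B]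
  [NormedAddCommGroup W] [InnerProductSpace ℝ W] [FiniteDimensional ℝ W]
  [NormedAddCommGroup T] [InnerProductSpace ℝ T] [FiniteDimensional ℝ T]
  [NormedAddCommGroup Bs] [InnerProductSpace ℝ Bs] [FiniteDimensional ℝ Bs]
  [NormedAddCommGroup V] [InnerProductSpace ℝ V] [FiniteDimensional ℝ V]
  {D : TwoScaleData A B W T Bs V}

/-- **(2.129) AS A FORM AT A VECTOR `u`**: bounds `‖H′_j*∂*u‖ ≤ Y₁`, `‖H_j*u‖ ≤ Y_H`, `⟨u, G̃_ju⟩ ≤ Y_G` at `u`, and the operator / form bounds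
`‖∂ΔH′_j‖ ≤ X₃`, `‖H_j‖ ≤ X_H`, `C^{(j)}_Λ ≤ X_C`, `G̃_j ≤ X_G`, `C̃^{(j)}_Λ ≤ X_Ct` give
**`⟨u, Gu⟩ ≤ X_CY₁² + 2(Y_G + X_CtY_H²) + 2(X_G + X_H²X_Ct)(X₃X_CY₁)²`** (`⟨u, K₁u⟩ = ⟨y, Cy⟩`, `y = H′_j*∂*u`; `K₂u = ∂ΔH′_jCy`;
`⟨(I − K₂)u, M(I − K₂)u⟩ ≤ 2⟨u, Mu⟩ + 2⟨K₂u, MK₂u⟩`, `M = G̃_j + H_jC̃H_j* ≥ 0`). [cite: Balaban1984PropagatorsII, (2.129) p.246, Prop. 2.5 p.246 (assembly ours)] -/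
theorem inner_G_le_of_bounds_at (hL : D.IsLattice) (hP : D.Positive) (u : A) {Y₁ YH YG X₃ XH XC XG XCt : ℝ}
    (h0₃ : 0 ≤ X₃) (h0XH : 0 ≤ XH) (h0C : 0 ≤ XC) (h0G : 0 ≤ XG) (h0Ct : 0 ≤ XCt)
    (hy : ‖LinearMap.adjoint D.hP (D.dv u)‖ ≤ Y₁) (hHu : ‖LinearMap.adjoint D.Hj u‖ ≤ YH) (hGu : ⟪u, D.Gt u⟫_ℝ ≤ YG)
    (h₃ : ∀ μ, ‖D.grad (D.lap (D.hP μ))‖ ≤ X₃ * ‖μ‖) (hH : ∀ b, ‖D.Hj b‖ ≤ XH * ‖b‖) (hC : ∀ v, ⟪v, D.C v⟫_ℝ ≤ XC * ‖v‖ ^ 2)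
    (hG : ∀ x, ⟪x, D.Gt x⟫_ℝ ≤ XG * ‖x‖ ^ 2) (hCt : ∀ b, ⟪b, D.Ct b⟫_ℝ ≤ XCt * ‖b‖ ^ 2) :
    ⟪u, D.G u⟫_ℝ ≤ XC * Y₁ ^ 2 + 2 * (YG + XCt * YH ^ 2) + 2 * (XG + XH ^ 2 * XCt) * (X₃ * XC * Y₁) ^ 2 := by
  set y := LinearMap.adjoint D.hP (D.dv u) with hy'
  have hC0 : ∀ v, 0 ≤ ⟪v, D.C v⟫_ℝ := inner_covOp_nonneg D.S₁ D.Dp (fun k hk => Dp_pos hL hP k hk)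
  have hCn : ‖D.C y‖ ≤ XC * ‖y‖ := norm_le_of_form_le D.C (C_symm hL hP) hC0 h0C hC y
  -- the first term
  have hK1 : ⟪u, D.K1 u⟫_ℝ ≤ XC * Y₁ ^ 2 := by
    rw [inner_K1_eq hL]
    exact (hC y).trans (mul_le_mul_of_nonneg_left (pow_le_pow_left₀ (norm_nonneg _) hy 2) h0C)
  -- `‖K₂u‖ ≤ X₃X_CY₁`
  have hK2 : ‖D.K2 u‖ ≤ X₃ * XC * Y₁ := by
    have e : D.K2 u = D.grad (D.lap (D.hP (D.C y))) := rfl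
    rw [e]
    calc ‖D.grad (D.lap (D.hP (D.C y)))‖ ≤ X₃ * ‖D.C y‖ := h₃ _
      _ ≤ X₃ * (XC * Y₁) := mul_le_mul_of_nonneg_left (hCn.trans (mul_le_mul_of_nonneg_left hy h0C)) h0₃
      _ = X₃ * XC * Y₁ := by ring
  -- the form of `M = G̃_j + H_jC̃H_j*`: non-negative, `≤ (X_G + X_H²X_Ct)‖·‖²`, and at `u`
  have hCt0 : ∀ b, 0 ≤ ⟪b, D.Ct b⟫_ℝ := inner_covOp_nonneg D.Ax D.Sb (fun m hm => Sb_pos hL hP m hm)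
  have hGt0 : ∀ x, 0 ≤ ⟪x, D.Gt x⟫_ℝ := inner_covOp_nonneg D.NA D.Mj (fun k hk => Mj_pos_ker hL hP (k : A) (LinearMap.mem_ker.mp k.2)
    (fun h => hk (Subtype.ext h)))
  have hMf : ∀ v, ⟪v, (D.Gt + D.Hj ∘ₗ D.Ct ∘ₗ LinearMap.adjoint D.Hj) v⟫_ℝ =
      ⟪v, D.Gt v⟫_ℝ + ⟪LinearMap.adjoint D.Hj v, D.Ct (LinearMap.adjoint D.Hj v)⟫_ℝ := fun v => by
    rw [LinearMap.add_apply, inner_add_right, LinearMap.comp_apply, LinearMap.comp_apply,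
      ← LinearMap.adjoint_inner_left D.Hj (D.Ct (LinearMap.adjoint D.Hj v)) v]
  have hM0 : ∀ v, 0 ≤ ⟪v, (D.Gt + D.Hj ∘ₗ D.Ct ∘ₗ LinearMap.adjoint D.Hj) v⟫_ℝ := fun v => by
    rw [hMf]; exact add_nonneg (hGt0 v) (hCt0 _)
  have hMle : ∀ v, ⟪v, (D.Gt + D.Hj ∘ₗ D.Ct ∘ₗ LinearMap.adjoint D.Hj) v⟫_ℝ ≤ (XG + XH ^ 2 * XCt) * ‖v‖ ^ 2 := fun v => by
    rw [hMf]
    have a1 := hG v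
    have a2 : ⟪LinearMap.adjoint D.Hj v, D.Ct (LinearMap.adjoint D.Hj v)⟫_ℝ ≤ XCt * (XH * ‖v‖) ^ 2 :=
      (hCt _).trans (mul_le_mul_of_nonneg_left (pow_le_pow_left₀ (norm_nonneg _) (norm_adjoint_le _ h0XH hH v) 2) h0Ct)
    have a3 : XCt * (XH * ‖v‖) ^ 2 = XH ^ 2 * XCt * ‖v‖ ^ 2 := by ring
    linarith
  have hMu : ⟪u, (D.Gt + D.Hj ∘ₗ D.Ct ∘ₗ LinearMap.adjoint D.Hj) u⟫_ℝ ≤ YG + XCt * YH ^ 2 := by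
    rw [hMf]
    exact add_le_add hGu ((hCt _).trans (mul_le_mul_of_nonneg_left (pow_le_pow_left₀ (norm_nonneg _) hHu 2) h0Ct))
  have hMK : ⟪D.K2 u, (D.Gt + D.Hj ∘ₗ D.Ct ∘ₗ LinearMap.adjoint D.Hj) (D.K2 u)⟫_ℝ ≤ (XG + XH ^ 2 * XCt) * (X₃ * XC * Y₁) ^ 2 :=
    (hMle _).trans (mul_le_mul_of_nonneg_left (pow_le_pow_left₀ (norm_nonneg _) hK2 2) (by positivity))
  have h2 := inner_sub_le_two_mul _ hM0 u (D.K2 u)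
  rw [eq2129_of_pos hL hP u]
  linarith

end Abstract

end Literature.MathematicalPhysics.QuantumFieldTheory.Balaban1983to89.B6Ineq190GradTwoScaleV1
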